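import Literature.NumberTheory.PAdicHodge.CyclotomicTilt
import Literature.NumberTheory.PAdicHodge.TruncatedLog
import HarnessLib

/-!
# `log[ε^a] ≡ a · log[ε]` to every order in `𝔸_inf(F)`

Let `F` be a `p`-adic local field, `𝔸_inf = 𝕎(𝒪_{ℂ_F}♭)`, `ξ` the generator of `ker θ`,
`ε = (ζ_{pⁿ})_n`, `u = [ε] - 1 ∈ ξ𝔸_inf`, and for `a ∈ ℤ_p` let `ε^a` be the `ℤ_p`-power in the tilt
(`CyclotomicTilt`). With `Λ_N = N!·L_N ∈ ℤ[X]` the integral truncated logarithm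
(`TruncatedLog.logTruncInt N`, `L_N(X) = Σ_{m<N} (-1)^m X^(m+1)/(m+1)`), the main result of this
file is the congruence

  `Λ_N([ε^a] - 1) - a · Λ_N(u) ∈ ξ^(N+1) 𝔸_inf`     (`aeval_logTruncInt_epsPow_sub_mem`)

for every `a ∈ ℤ_p` and every `N` — the integral, finite-level form of `log [ε^a] = a · log [ε]`,
from which `σ(t) = χ(σ)·t` for `t = log [ε] ∈ B_dR⁺` follows (`σ[ε] = [ε^{χ(σ)}]`).
Proof (Fontaine 1994, Exp. II, 1.5.4, made finite): for `a = n ∈ ℕ` it is the truncated functional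
equation `X^(N+1) ∣ Λ_N((1+X)ⁿ - 1) - n·Λ_N(X)` evaluated at `u` (`TruncatedLog.X_pow_dvd_int`);
both sides are `p`-adically continuous in `a` modulo `ξ^(N+1)`
(`[ε^{pᴷb}] - 1 = ([ε^b])^(pᴷ) - 1 ∈ (p^(K-N), ξ^(N+1))`, `TruncatedLog.exists_one_add_pow_prime_pow`),
and `ξ^(N+1)𝔸_inf` is `p`-adically closed (`mem_span_xi_pow_of_forall`).

## References
* [FontaineAsterisque223III] J.-M. Fontaine, *Le corps des périodes p-adiques*, Astérisque 223
  (1994), Exp. II, §1.5.4.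
* [FontaineOuyang2022] J.-M. Fontaine, Y. Ouyang, *Theory of p-adic Galois representations*,
  §5.1.2.
-/

noncomputable section

open ValuativeRel Field Ideal WittVector UniformSpace Polynomial

namespace Literature.NumberTheory.PAdicHodge

open Literature.NumberTheory.GaloisRepresentations
open Literature.NumberTheory.GaloisRepresentations.IsNonarchimedeanLocalField
open TruncatedLog

variable {F : Type} [Field F] [ValuativeRel F] [TopologicalSpace F] [IsNonarchimedeanLocalField F]
  [CharZero F] {p : ℕ} [Fact p.Prime] [Fact (¬ IsUnit (p : integerC F))]
  [IsAdicComplete (Ideal.span {(p : integerC F)}) (integerC F)]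

/-- **Integer exponents**: `Λ_N([ε]ⁿ - 1) - n·Λ_N(u) ∈ ξ^(N+1)𝔸_inf` (the truncated functional
equation of the logarithm evaluated at `u = [ε] - 1 ∈ ξ𝔸_inf`). [cite: FontaineAsterisque223III, Exp. II §1.5.4] -/
theorem aeval_logTruncInt_teichmuller_pow_sub_mem (n N : ℕ) :
    aeval (teichmuller p (eps : PreTilt (integerC F) p) ^ n - 1) (logTruncInt N) -
        n * aeval (uAinf : Ainf (p := p) F) (logTruncInt N) ∈
      Ideal.span {(xi : Ainf (p := p) F) ^ (N + 1)} := by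
  obtain ⟨c, hc⟩ := exists_aeval_sub_eq (uAinf : Ainf (p := p) F) n N
  have h1 : (1 + uAinf : Ainf (p := p) F) = teichmuller p (eps : PreTilt (integerC F) p) := by
    rw [uAinf_def]; ring
  rw [h1] at hc
  rw [hc]
  obtain ⟨u', hu'⟩ := xi_dvd_uAinf (F := F) (p := p)
  rw [hu', mul_pow, mul_assoc]
  exact Ideal.mul_mem_right _ _ (Ideal.mem_span_singleton_self _)

/-- **`Λ_N([ε^a] - 1) - a·Λ_N(u) ∈ ξ^(N+1)𝔸_inf` for every `a ∈ ℤ_p`** — `log [ε^a] ≡ a·log [ε]` to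
every order (exact for `a ∈ ℕ`; `p`-adic continuity in `a`; `ξ^(N+1)𝔸_inf` is `p`-adically closed).
[cite: FontaineAsterisque223III, Exp. II §1.5.4] [cite: FontaineOuyang2022, §5.1.2] -/
theorem aeval_logTruncInt_epsPow_sub_mem (a : ℤ_[p]) (N : ℕ) :
    aeval (teichmuller p (epsPow a : PreTilt (integerC F) p) - 1) (logTruncInt N) -
        zpToAinf a * aeval (uAinf : Ainf (p := p) F) (logTruncInt N) ∈
      Ideal.span {(xi : Ainf (p := p) F) ^ (N + 1)} := by
  refine mem_span_xi_pow_of_forall (N + 1) fun m => ?_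
  obtain ⟨b, hab⟩ := exists_eq_natCast_add_pow_mul a (m + N)
  set n : ℕ := (PadicInt.toZModPow (m + N) a).val with hn
  -- `[ε^b] - 1 = ξ w'`
  obtain ⟨w', hw'⟩ := xi_dvd_teichmuller_epsPow_sub_one (F := F) (p := p) b
  -- `[ε^b]^(p^(m+N)) - 1 = p^m b₁ + ([ε^b] - 1)^(N+1) c₁`
  obtain ⟨b₁, c₁, hbc⟩ := exists_one_add_pow_prime_pow p
    (teichmuller p (epsPow b : PreTilt (integerC F) p) - 1) N (m + N)
  rw [Nat.add_sub_cancel, add_sub_cancel, hw'] at hbc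
  -- the integer case
  obtain ⟨c₂, hc₂⟩ := Ideal.mem_span_singleton'.1
    (aeval_logTruncInt_teichmuller_pow_sub_mem (F := F) (p := p) n N)
  -- `Λ_N(x) - Λ_N(y) = (x - y) e`
  obtain ⟨e, he⟩ := sub_dvd_aeval_sub (teichmuller p (epsPow a : PreTilt (integerC F) p) - 1)
    (teichmuller p (eps : PreTilt (integerC F) p) ^ n - 1) N
  -- `[ε^a] = [ε]ⁿ [ε^b]^(p^(m+N))`, `a = n + p^(m+N) b`
  have hTa : teichmuller p (epsPow a : PreTilt (integerC F) p) =
      teichmuller p (eps : PreTilt (integerC F) p) ^ n *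
        teichmuller p (epsPow b : PreTilt (integerC F) p) ^ p ^ (m + N) := by
    conv_lhs => rw [hab, epsPow_add, epsPow_natCast, epsPow_pow_mul, map_mul, map_pow, map_pow]
  have hzp : zpToAinf a = (n : Ainf (p := p) F) + (p : Ainf (p := p) F) ^ (m + N) * zpToAinf b := by
    conv_lhs => rw [hab, map_add, map_natCast, map_mul, map_pow, map_natCast]
  refine ⟨teichmuller p (eps : PreTilt (integerC F) p) ^ n * w' ^ (N + 1) * c₁ * e + c₂,
    teichmuller p (eps : PreTilt (integerC F) p) ^ n * b₁ * e -
      (p : Ainf (p := p) F) ^ N * zpToAinf b * aeval (uAinf : Ainf (p := p) F) (logTruncInt N), ?_⟩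
  linear_combination he + e * hTa + (teichmuller p (eps : PreTilt (integerC F) p) ^ n * e) * hbc -
    hc₂ - aeval (uAinf : Ainf (p := p) F) (logTruncInt N) * hzp

/-- The same congruence for the Galois conjugates of `u`:
`Λ_N(𝕎(σ♭) u) - χ(σ)·Λ_N(u) ∈ ξ^(N+1)𝔸_inf` (`𝕎(σ♭) u = [ε^{χ(σ)}] - 1`).
[cite: FontaineAsterisque223III, Exp. II §1.5.4] -/
theorem aeval_logTruncInt_galAinf_uAinf_sub_mem (σ : absoluteGaloisGroup F) (N : ℕ) :
    aeval (galAinf σ (uAinf : Ainf (p := p) F)) (logTruncInt N) -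
        zpToAinf ((GaloisRep.cyclotomicCharacter F p σ : ℤ_[p]ˣ) : ℤ_[p]) *
          aeval (uAinf : Ainf (p := p) F) (logTruncInt N) ∈
      Ideal.span {(xi : Ainf (p := p) F) ^ (N + 1)} := by
  rw [galAinf_uAinf]
  exact aeval_logTruncInt_epsPow_sub_mem _ N

end Literature.NumberTheory.PAdicHodge

end
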